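import Literature.AlgebraicGeometry.HodgeTheory.GAGADimensionCharts
import Literature.AlgebraicGeometry.HodgeTheory.EmbeddedVarietyImmersion
import Literature.AlgebraicGeometry.Motives.UniversalHyperplaneSectionChart
import Literature.Geometry.Kaehler.AnalyticSetRegular
import Literature.Analysis.Complex.OsgoodProofs
import Literature.NumberTheory.Transcendental.AnalytificationFunctorialityProofs
import Mathlib.Geometry.Manifold.MFDeriv.Atlas
import HarnessLib

/-!
# Projective manifolds — smoothness of the algebraisation, part (G1): the affine chart at a point and the differential of regular functions along the manifold

Support file of the algebraisation package `Literature.AlgebraicGeometry.Motives.ProjectiveManifold`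
(re-homed verbatim from `Summits/HodgeConjecture/HodgeConjecture/Theorems/SecondaryPeriodsRiemannWeightOneStubAlgebraisationSmoothAffineChart.lean`,
route `SecondaryPeriods`, crux `RiemannWeightOne`, where it was first proved; Literature cannot
import Summits). Helper file for `ProjectiveManifold.isSmoothProjective_of_isAnalytification`
(`ProjectiveManifoldSmooth`; Serre, GAGA §2 n°6). Setting: a
closed subscheme `ι : X ↪ ℙ^{N'+1}_ℂ`, a complex `n`-manifold `M` with an analytification
`φ : M → X(ℂ)` and a holomorphic `F : M → ℙ(ℂ^{N'+2})` with `ι(ℂ) ∘ φ = projPoint ∘ F`.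

* Points of an affine open `U` as `ℂ`-algebra maps `Γ(X, U) → ℂ` and back (`evalAlgHom`,
  `pointOf`, with the dictionary `eval_pointOf`, `pointOf_evalAlgHom`, `pointOf_injective`);
* `chartOfAnalytification` — the chart `e = (chart of M at m₀) ∘ φ⁻¹` of `X(ℂ)`, in which every
  regular function is holomorphic (`contDiffOn_chartOfAnalytification`), so that the tree's
  calculus of differentials of regular functions in a chart (`GAGADimension.fderiv_chart_*`)
  applies;
* `pointDerivation` — **the differential at `m₀`**, `δ(b) = d(b ∘ φ ∘ chart⁻¹)(chart m₀)`, a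
  `ℂ`-linear point derivation `Γ(X, U) → (ℂⁿ)^*` at the evaluation `e₀` at `φ m₀`;
* `span_pointDerivation_coordFn_eq_top` — **if `F` is an immersion at `m₀` then the differentials
  of the affine coordinate functions `ι^*(X_k/Xᵢ)` (the tree's `hypersurfaceCoordFn`) span
  `(ℂⁿ)^*`** (they are the components of `F` in the standard chart `i` of `ℙ`, and the
  differential of `F` at `m₀` is injective).

## References

* [SerreGAGA1956] J.-P. Serre, GAGA, Ann. Inst. Fourier 6 (1956), §2 n°5 Lemme 1, Prop. 2, n°6.
-/

noncomputable section


namespace Literature.AlgebraicGeometry.Motives.ProjectiveManifold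

namespace AffineChart

open scoped Manifold ContDiff _root_.Topology LinearAlgebra.Projectivization
open CategoryTheory _root_.AlgebraicGeometry Filter Set Function
open Literature.AlgebraicGeometry.Motives Literature.AlgebraicGeometry.Motives.AlgPoints
open Literature.NumberTheory.Transcendental (IsAnalytification projPoint)
open Literature.AlgebraicGeometry.HodgeTheory

attribute [local instance] UniversalHyperplaneSection.sectionsAlgebra

/-! ### Points of an affine open as algebra maps -/

section Points

variable {X : SchemeOver ℂ} (U : X.left.affineOpens)

/-- The evaluation at a complex point `P` of `U` as a `ℂ`-algebra map `Γ(X, U) → ℂ`. [folklore] -/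
def evalAlgHom (P : ComplexPoints X) (hP : P.pt ∈ (↑U : X.left.Opens)) : Γ(X.left, ↑U) →ₐ[ℂ] ℂ :=
  { P.evalRingHom ↑U hP with
    commutes' := fun c => by
      change P.eval ↑U hP (SchemeOver.scalarRingHom X ↑U c) = c
      rw [AlgPoints.eval_scalarRingHom]; rfl }

/-- Unfolding `evalAlgHom`: the `ℂ`-algebra map of a complex point is evaluation (points of an
affine scheme with values in `ℂ` ↔ ring maps to `ℂ`). [cite: Hartshorne1977, II Ex. 2.4] -/
@[simp] theorem evalAlgHom_apply (P : ComplexPoints X) (hP : P.pt ∈ (↑U : X.left.Opens))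
    (b : Γ(X.left, ↑U)) : evalAlgHom U P hP b = P.eval ↑U hP b := rfl

/-- The complex point of `U` attached to a `ℂ`-algebra map `ψ : Γ(X, U) → ℂ`. [folklore] -/
def pointOf (ψ : Γ(X.left, ↑U) →ₐ[ℂ] ℂ) : ComplexPoints X :=
  AlgPoints.ofRingHom U.2 ψ.toRingHom (RingHom.ext fun c => ψ.commutes c)

/-- `pointOf U ψ` lies over `U`. [cite: Hartshorne1977, II Ex. 2.4] -/
theorem pt_pointOf_mem (ψ : Γ(X.left, ↑U) →ₐ[ℂ] ℂ) : (pointOf U ψ).pt ∈ (↑U : X.left.Opens) :=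
  AlgPoints.pt_ofRingHom_mem U.2 _ _

/-- Evaluation at `pointOf U ψ` is `ψ` (points ↔ algebra maps). [cite: Hartshorne1977, II Ex. 2.4] -/
theorem eval_pointOf (ψ : Γ(X.left, ↑U) →ₐ[ℂ] ℂ) (h : (pointOf U ψ).pt ∈ (↑U : X.left.Opens))
    (b : Γ(X.left, ↑U)) : (pointOf U ψ).eval ↑U h b = ψ b :=
  AlgPoints.eval_ofRingHom U.2 _ _ h b

/-- `evalAlgHom ∘ pointOf = id`. [folklore] -/
private theorem evalAlgHom_pointOf (ψ : Γ(X.left, ↑U) →ₐ[ℂ] ℂ) :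
    evalAlgHom U (pointOf U ψ) (pt_pointOf_mem U ψ) = ψ :=
  AlgHom.ext fun b => eval_pointOf U ψ _ b

/-- `pointOf ∘ evalAlgHom = id` (complex points of an affine open are determined by evaluation).
[cite: Hartshorne1977, II Ex. 2.4] -/
theorem pointOf_evalAlgHom (P : ComplexPoints X) (hP : P.pt ∈ (↑U : X.left.Opens)) :
    pointOf U (evalAlgHom U P hP) = P :=
  AlgPoints.ext_of_forall_eval_eq U.2 (pt_pointOf_mem U _) hP fun b => by
    rw [eval_pointOf]; rfl

/-- `pointOf` is injective (points ↔ algebra maps). [cite: Hartshorne1977, II Ex. 2.4] -/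
theorem pointOf_injective : Injective (pointOf U) := fun ψ ψ' h => by
  rw [← evalAlgHom_pointOf U ψ, ← evalAlgHom_pointOf U ψ']
  have hmem : (pointOf U ψ').pt ∈ (↑U : X.left.Opens) := pt_pointOf_mem U ψ'
  have : ∀ (h₁ : (pointOf U ψ).pt ∈ (↑U : X.left.Opens)),
      evalAlgHom U (pointOf U ψ) h₁ = evalAlgHom U (pointOf U ψ') hmem := by
    rw [h]; intro; rfl
  exact this _

/-- `evalOrZero` at `pointOf U ψ` is `ψ`. [cite: Hartshorne1977, II Ex. 2.4] -/
theorem evalOrZero_pointOf (ψ : Γ(X.left, ↑U) →ₐ[ℂ] ℂ) (b : Γ(X.left, ↑U)) :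
    evalOrZero ↑U b (pointOf U ψ) = ψ b := by
  rw [evalOrZero_of_mem _ (pt_pointOf_mem U ψ), eval_pointOf]

end Points

/-! ### The chart of `X(ℂ)` induced by an analytification -/

section Chart

variable {n : ℕ} {M : Type*} [TopologicalSpace M] [ChartedSpace (Fin n → ℂ) M]
  {X : SchemeOver ℂ} {φ : M → ComplexPoints X} (hφ : IsAnalytification (Fin n → ℂ) X n φ) (m₀ : M)

/-- The chart `e = (chartAt m₀) ∘ φ⁻¹ : X(ℂ) ⇀ ℂⁿ` of `X(ℂ)` transported from `M`. [folklore] -/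
def chartOfAnalytification : OpenPartialHomeomorph (ComplexPoints X) (Fin n → ℂ) :=
  hφ.homeomorph.symm.toOpenPartialHomeomorph.trans (chartAt (Fin n → ℂ) m₀)

/-- `e.symm = φ ∘ (chartAt m₀).symm` (the analytic structure of `X(ℂ)` is the one transported
from `M`). [cite: SerreGAGA1956, §2 (définition de X^h)] -/
theorem chartOfAnalytification_symm_apply (z : Fin n → ℂ) :
    (chartOfAnalytification hφ m₀).symm z = φ ((chartAt (Fin n → ℂ) m₀).symm z) := rfl

/-- `e (φ m) = chartAt m₀ m`. [cite: SerreGAGA1956, §2 (définition de X^h)] -/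
theorem chartOfAnalytification_apply (m : M) :
    chartOfAnalytification hφ m₀ (φ m) = chartAt (Fin n → ℂ) m₀ m := by
  change chartAt (Fin n → ℂ) m₀ (hφ.homeomorph.symm (φ m)) = _
  congr 1
  exact hφ.homeomorph.symm_apply_apply m

/-- `φ m₀ ∈ e.source`. [cite: SerreGAGA1956, §2 (définition de X^h)] -/
theorem mem_chartOfAnalytification_source : φ m₀ ∈ (chartOfAnalytification hφ m₀).source := by
  change φ m₀ ∈ univ ∩ hφ.homeomorph.symm ⁻¹' (chartAt (Fin n → ℂ) m₀).source
  refine ⟨trivial, ?_⟩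
  rw [mem_preimage, show hφ.homeomorph.symm (φ m₀) = m₀ from hφ.homeomorph.symm_apply_apply m₀]
  exact mem_chart_source _ m₀

/-- `e.target = (chartAt m₀).target`. [folklore] -/
private theorem chartOfAnalytification_target :
    (chartOfAnalytification hφ m₀).target = (chartAt (Fin n → ℂ) m₀).target := by
  rw [chartOfAnalytification, OpenPartialHomeomorph.trans_target,
    Homeomorph.toOpenPartialHomeomorph_target, preimage_univ, inter_univ]

variable [IsManifold 𝓘(ℂ, Fin n → ℂ) ω M]

/-- **Regular functions are holomorphic in the transported chart** (from the defining property of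
an analytification). [cite: SerreGAGA1956, §2 n°5 Prop. 2] -/
theorem contDiffOn_chartOfAnalytification (U : X.left.affineOpens) (s : Γ(X.left, ↑U)) :
    ContDiffOn ℂ ω (evalOrZero ↑U s ∘ (chartOfAnalytification hφ m₀).symm)
      ((chartOfAnalytification hφ m₀).target ∩
        (chartOfAnalytification hφ m₀).symm ⁻¹' {Q | Q.pt ∈ (↑U : X.left.Opens)}) := by
  have hmd := hφ.mdifferentiableOn_evalOrZero U s
  have hdiff : DifferentiableOn ℂ ((fun m => evalOrZero ↑U s (φ m)) ∘ (extChartAt 𝓘(ℂ, Fin n → ℂ) m₀).symm)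
      ((extChartAt 𝓘(ℂ, Fin n → ℂ) m₀).target ∩
        (extChartAt 𝓘(ℂ, Fin n → ℂ) m₀).symm ⁻¹' (φ ⁻¹' {P | P.pt ∈ (↑U : X.left.Opens)})) :=
    Literature.Geometry.Kaehler.MDifferentiableOn.differentiableOn_extChartAt_symm hmd m₀
  have hopen : IsOpen ((extChartAt 𝓘(ℂ, Fin n → ℂ) m₀).target ∩
      (extChartAt 𝓘(ℂ, Fin n → ℂ) m₀).symm ⁻¹' (φ ⁻¹' {P | P.pt ∈ (↑U : X.left.Opens)})) :=
    Literature.Geometry.Kaehler.isOpen_extChartAt_target_inter_preimage_symm m₀ (hφ.isOpen_preimage ↑U)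
  have heq : (chartOfAnalytification hφ m₀).target ∩
      (chartOfAnalytification hφ m₀).symm ⁻¹' {Q | Q.pt ∈ (↑U : X.left.Opens)} =
      (extChartAt 𝓘(ℂ, Fin n → ℂ) m₀).target ∩
        (extChartAt 𝓘(ℂ, Fin n → ℂ) m₀).symm ⁻¹' (φ ⁻¹' {P | P.pt ∈ (↑U : X.left.Opens)}) := by
    rw [chartOfAnalytification_target, extChartAt_target]
    simp only [modelWithCornersSelf_coe, range_id, inter_univ, modelWithCornersSelf_coe_symm,
      preimage_id_eq, id_eq]
    rfl
  have hfun : evalOrZero ↑U s ∘ (chartOfAnalytification hφ m₀).symm =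
      (fun m => evalOrZero ↑U s (φ m)) ∘ (extChartAt 𝓘(ℂ, Fin n → ℂ) m₀).symm := by
    funext z
    simp only [Function.comp_apply, chartOfAnalytification_symm_apply, extChartAt,
      OpenPartialHomeomorph.extend, modelWithCornersSelf_partialEquiv, PartialEquiv.trans_refl,
      OpenPartialHomeomorph.coe_toPartialEquiv_symm]
  rw [heq, hfun]
  exact (Literature.Analysis.Complex.SCV.analyticOnNhd_of_differentiableOn hdiff hopen).contDiffOn_of_completeSpace

end Chart

/-! ### The point derivation at `m₀` -/

section Derivation

variable {n : ℕ} {M : Type*} [TopologicalSpace M] [ChartedSpace (Fin n → ℂ) M]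
  [IsManifold 𝓘(ℂ, Fin n → ℂ) ω M]
  {X : SchemeOver ℂ} {φ : M → ComplexPoints X} (hφ : IsAnalytification (Fin n → ℂ) X n φ) (m₀ : M)
  (U : X.left.affineOpens) (hm₀ : (φ m₀).pt ∈ (↑U : X.left.Opens))

/-- **The differential at `m₀` of regular functions along `φ`**: `δ(b) = d(b ∘ e⁻¹)(e(φ m₀))` for
the transported chart `e`, a `ℂ`-linear map `Γ(X, U) → (ℂⁿ)^*` (additivity and homogeneity are the
tree's `GAGADimension.fderiv_chart_add`, `fderiv_chart_smul`). [cite: SerreGAGA1956, §2 n°6] -/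
def pointDerivation : Γ(X.left, ↑U) →ₗ[ℂ] ((Fin n → ℂ) →L[ℂ] ℂ) where
  toFun b := fderiv ℂ (evalOrZero ↑U b ∘ (chartOfAnalytification hφ m₀).symm)
    (chartOfAnalytification hφ m₀ (φ m₀))
  map_add' b b' := GAGADimension.fderiv_chart_add _ (mem_chartOfAnalytification_source hφ m₀)
    (contDiffOn_chartOfAnalytification hφ m₀) U hm₀ b b'
  map_smul' c b := by
    rw [RingHom.id_apply, Algebra.smul_def]
    exact GAGADimension.fderiv_chart_smul _ (mem_chartOfAnalytification_source hφ m₀)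
      (contDiffOn_chartOfAnalytification hφ m₀) U hm₀ c b

/-- Unfolding `pointDerivation` (the differential of a regular function read in a chart of `X^h`).
[cite: SerreGAGA1956, §2 n°6] -/
theorem pointDerivation_apply (b : Γ(X.left, ↑U)) :
    pointDerivation hφ m₀ U hm₀ b = fderiv ℂ (evalOrZero ↑U b ∘ (chartOfAnalytification hφ m₀).symm)
      (chartAt (Fin n → ℂ) m₀ m₀) := by
  rw [← chartOfAnalytification_apply hφ m₀ m₀]; rfl

/-- **Leibniz rule**: `δ` is a point derivation at the evaluation at `φ m₀`
(`GAGADimension.fderiv_chart_mul`). [cite: SerreGAGA1956, §2 n°6] -/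
theorem pointDerivation_mul (b c : Γ(X.left, ↑U)) :
    pointDerivation hφ m₀ U hm₀ (b * c) =
      evalAlgHom U (φ m₀) hm₀ b • pointDerivation hφ m₀ U hm₀ c +
        evalAlgHom U (φ m₀) hm₀ c • pointDerivation hφ m₀ U hm₀ b :=
  GAGADimension.fderiv_chart_mul _ (mem_chartOfAnalytification_source hφ m₀)
    (contDiffOn_chartOfAnalytification hφ m₀) U hm₀ b c

omit [IsManifold 𝓘(ℂ, Fin n → ℂ) ω M] in
include hφ hm₀ in
/-- The chart-read regular function near `chartAt m₀ m₀` takes at `z` the value at the point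
`φ(chart⁻¹ z) ∈ U(ℂ)`. [folklore] -/
private theorem eventually_mem_chart :
    ∀ᶠ z in 𝓝 (chartAt (Fin n → ℂ) m₀ m₀), z ∈ (chartAt (Fin n → ℂ) m₀).target ∧
      (φ ((chartAt (Fin n → ℂ) m₀).symm z)).pt ∈ (↑U : X.left.Opens) := by
  have h := GAGADimension.eventually_chart_mem _ (mem_chartOfAnalytification_source hφ m₀) hm₀
  rw [chartOfAnalytification_apply, chartOfAnalytification_target] at h
  exact h

end Derivation

/-- If finitely many functionals `f_j` on a finite-dimensional space have injective joint map
`x ↦ (f_j x)_j`, they span the (continuous) dual (duality of finite-dimensional spaces: the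
annihilator of their span is `0`). [cite: Lang2002, Ch. III §6 (the dual space)] -/
theorem span_eq_top_of_injective_pi {E : Type*} [NormedAddCommGroup E] [NormedSpace ℂ E]
    [FiniteDimensional ℂ E] {κ : Type*} [Fintype κ] (f : κ → E →L[ℂ] ℂ)
    (hinj : Injective fun x : E => fun j : κ => f j x) :
    Submodule.span ℂ (Set.range f) = ⊤ := by
  classical
  -- a linear left inverse of the joint map
  set A : E →ₗ[ℂ] (κ → ℂ) := LinearMap.pi fun j => (f j : E →ₗ[ℂ] ℂ) with hA
  have hAinj : Injective A := fun x y h => hinj (by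
    funext j
    have := congrFun h j
    simpa [hA] using this)
  obtain ⟨L, hL⟩ := LinearMap.exists_leftInverse_of_injective A (LinearMap.ker_eq_bot.2 hAinj)
  refine eq_top_iff.2 fun g _ => ?_
  -- `g = Σ_j g(L e_j) • f_j`
  have key : g = ∑ j, g (L (Pi.single j 1)) • f j := by
    ext x
    have hx : x = L (A x) := by
      have := congrArg (fun h : E →ₗ[ℂ] E => h x) hL
      simpa using this.symm
    have hAx : A x = ∑ j, (f j x) • (Pi.single j (1 : ℂ) : κ → ℂ) := by
      funext j'
      simp [hA, Pi.single_apply, Finset.sum_apply]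
    calc g x = g (L (A x)) := by rw [← hx]
      _ = ∑ j, f j x * g (L (Pi.single j 1)) := by
        rw [hAx, map_sum, map_sum]
        exact Finset.sum_congr rfl fun j _ => by rw [_root_.map_smul, _root_.map_smul, smul_eq_mul]
      _ = (∑ j, g (L (Pi.single j 1)) • f j) x := by
        rw [sum_apply]
        exact Finset.sum_congr rfl fun j _ => by rw [smul_apply, smul_eq_mul, mul_comm]
  rw [key]
  exact Submodule.sum_mem _ fun j _ => Submodule.smul_mem _ _ (Submodule.subset_span ⟨j, rfl⟩)

/-! ### The immersion hypothesis: the affine coordinates span the cotangent space -/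

section Immersion

/-- `hypersurfacePoint ι ∘ φ = F` when both have comparison point `ι(φ m)`. [folklore] -/
private theorem hypersurfacePoint_comp {N' : ℕ} {M : Type*} {X : SchemeOver ℂ}
    (ι : X ⟶ projectiveSpace (N' + 1) ℂ) {φ : M → ComplexPoints X} (F : M → ℙ ℂ (Fin (N' + 2) → ℂ))
    (hcomp : ∀ m, AlgPoints.map ι (φ m) = projPoint (N' + 1) (F m)) (m : M) :
    hypersurfacePoint ι (φ m) = F m :=
  hypersurfacePoint_eq_of_projPoint_eq ι (φ m) (hcomp m).symm

variable {n N' : ℕ} {M : Type*} [TopologicalSpace M] [ChartedSpace (Fin n → ℂ) M]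
  [IsManifold 𝓘(ℂ, Fin n → ℂ) ω M]
  {X : SchemeOver ℂ} (ι : X ⟶ projectiveSpace (N' + 1) ℂ) [IsClosedImmersion ι.left]
  {φ : M → ComplexPoints X} (hφ : IsAnalytification (Fin n → ℂ) X n φ)
  (F : M → ℙ ℂ (Fin (N' + 2) → ℂ)) (hcomp : ∀ m, AlgPoints.map ι (φ m) = projPoint (N' + 1) (F m))

/-- The index of the standard chart of `ℙ` at `p` (the chart at `p` of the tree's atlas is
`stdChart (chartIndex p)`, by `rfl`). [folklore] -/
def chartIndex (p : ℙ ℂ (Fin (N' + 2) → ℂ)) : Fin (N' + 2) :=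
  Classical.choose (Projectivization.exists_rep_apply_ne_zero p)

/-- `p` lies in the source of its standard chart. [folklore] -/
private theorem mem_stdChart_source (p : ℙ ℂ (Fin (N' + 2) → ℂ)) :
    p ∈ (Projectivization.stdChart (chartIndex p)).source :=
  mem_chart_source (Fin (N' + 1) → ℂ) p

/-- The affine open `U₀ = ι⁻¹(D₊(Xᵢ))` of `X` at `m₀`, `i` the chart index of `F m₀`. [folklore] -/
def affineOpenAt (m₀ : M) : X.left.affineOpens := hypersurfaceAffineChart ι (chartIndex (F m₀))

omit [TopologicalSpace M] [ChartedSpace (Fin n → ℂ) M] [IsManifold 𝓘(ℂ, Fin n → ℂ) ω M] in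
include hcomp in
/-- `φ m₀` lies over the affine open `ι⁻¹(D₊(Xᵢ))` at `m₀` (the standard affine cover of `ℙᴺ`
pulled back to the closed subscheme). [cite: Hartshorne1977, II Prop. 2.5 (b)] -/
theorem pt_mem_affineOpenAt (m₀ : M) : (φ m₀).pt ∈ (↑(affineOpenAt ι F m₀) : X.left.Opens) :=
  (mem_hypersurfaceAffineChart_iff ι _ _).2 (by
    rw [hypersurfacePoint_comp ι F hcomp]; exact mem_stdChart_source (F m₀))

/-- The affine coordinate functions `ι^*(X_k/Xᵢ) ∈ Γ(X, U₀)`. [folklore] -/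
def coordFn (m₀ : M) (j : Fin (N' + 1)) : Γ(X.left, ↑(affineOpenAt ι F m₀)) :=
  hypersurfaceCoordFn ι (chartIndex (F m₀)) j

omit [IsManifold 𝓘(ℂ, Fin n → ℂ) ω M] in
include hcomp in
/-- Near `chartAt m₀ m₀`, the chart-read coordinate function `ι^*(X_k/Xᵢ)` is the `j`-th component
of `F` in the standard chart. [cite: SerreGAGA1956, §2 n°5 Lemme 1 c)] -/
theorem coordFn_eventuallyEq (m₀ : M) (j : Fin (N' + 1)) :
    (evalOrZero ↑(affineOpenAt ι F m₀) (coordFn ι F m₀ j) ∘ (chartOfAnalytification hφ m₀).symm)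
      =ᶠ[𝓝 (chartAt (Fin n → ℂ) m₀ m₀)]
      fun z => Projectivization.stdChart (chartIndex (F m₀)) (F ((chartAt (Fin n → ℂ) m₀).symm z)) j := by
  filter_upwards [eventually_mem_chart hφ m₀ (affineOpenAt ι F m₀) (pt_mem_affineOpenAt ι F hcomp m₀)]
    with z hz
  rw [Function.comp_apply, chartOfAnalytification_symm_apply]
  exact (evalOrZero_hypersurfaceCoordFn ι _ j _ hz.2).trans (by rw [hypersurfacePoint_comp ι F hcomp])

omit [IsManifold 𝓘(ℂ, Fin n → ℂ) ω M] in
/-- **The differential of `F` in charts.** If `F` is differentiable at `m₀` with injective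
differential, the map `z ↦ stdChartᵢ(F(chart⁻¹ z))` has injective differential at `chartAt m₀ m₀`
(this map is `F` written in the charts `chartAt m₀` and `chartAt (F m₀) = stdChartᵢ`).
[folklore] -/
private theorem injective_fderiv_written (m₀ : M)
    (hFd : MDifferentiableAt 𝓘(ℂ, Fin n → ℂ) 𝓘(ℂ, Fin (N' + 1) → ℂ) F m₀)
    (hdF : Injective (mfderiv 𝓘(ℂ, Fin n → ℂ) 𝓘(ℂ, Fin (N' + 1) → ℂ) F m₀)) :
    Injective (fderiv ℂ (fun z => Projectivization.stdChart (chartIndex (F m₀))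
      (F ((chartAt (Fin n → ℂ) m₀).symm z))) (chartAt (Fin n → ℂ) m₀ m₀)) := by
  have h := hFd.mfderiv
  rw [h] at hdF
  simp only [writtenInExtChartAt, extChartAt, OpenPartialHomeomorph.extend,
    modelWithCornersSelf_partialEquiv, PartialEquiv.trans_refl, modelWithCornersSelf_coe,
    Set.range_id, fderivWithin_univ, OpenPartialHomeomorph.toFun_eq_coe,
    OpenPartialHomeomorph.coe_toPartialEquiv_symm] at hdF
  exact hdF

include hcomp in
/-- **The affine coordinate functions span the cotangent space at an immersive point**: if `F` is
differentiable at `m₀` with injective differential, then the differentials at `m₀` of the regular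
functions `ι^*(X_k/Xᵢ)` along `φ` span `(ℂⁿ)^*`. [cite: SerreGAGA1956, §2 n°6] -/
theorem span_pointDerivation_coordFn_eq_top (m₀ : M)
    (hFd : MDifferentiableAt 𝓘(ℂ, Fin n → ℂ) 𝓘(ℂ, Fin (N' + 1) → ℂ) F m₀)
    (hdF : Injective (mfderiv 𝓘(ℂ, Fin n → ℂ) 𝓘(ℂ, Fin (N' + 1) → ℂ) F m₀)) :
    Submodule.span ℂ (Set.range fun j : Fin (N' + 1) =>
      pointDerivation hφ m₀ (affineOpenAt ι F m₀) (pt_mem_affineOpenAt ι F hcomp m₀) (coordFn ι F m₀ j)) = ⊤ := by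
  set c₀ := chartAt (Fin n → ℂ) m₀ m₀ with hc₀
  set G : (Fin n → ℂ) → (Fin (N' + 1) → ℂ) := fun z =>
    Projectivization.stdChart (chartIndex (F m₀)) (F ((chartAt (Fin n → ℂ) m₀).symm z)) with hG
  -- each component of `G` is the chart-read coordinate function, differentiable at `c₀`
  have hcomp' : ∀ j, (evalOrZero ↑(affineOpenAt ι F m₀) (coordFn ι F m₀ j) ∘
      (chartOfAnalytification hφ m₀).symm) =ᶠ[𝓝 c₀] fun z => G z j :=
    fun j => coordFn_eventuallyEq ι hφ F hcomp m₀ j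
  have hdiffj : ∀ j, DifferentiableAt ℂ (fun z => G z j) c₀ := fun j => by
    have hd := GAGADimension.differentiableAt_chart _ (mem_chartOfAnalytification_source hφ m₀)
      (contDiffOn_chartOfAnalytification hφ m₀) (affineOpenAt ι F m₀)
      (pt_mem_affineOpenAt ι F hcomp m₀) (coordFn ι F m₀ j)
    rw [chartOfAnalytification_apply] at hd
    exact hd.congr_of_eventuallyEq (hcomp' j).symm
  have hdiffG : DifferentiableAt ℂ G c₀ := differentiableAt_pi.2 hdiffj
  -- the differentials of the coordinate functions are the components of `dG(c₀)`
  have hδ : ∀ j, pointDerivation hφ m₀ (affineOpenAt ι F m₀) (pt_mem_affineOpenAt ι F hcomp m₀)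
      (coordFn ι F m₀ j) = fderiv ℂ (fun z => G z j) c₀ := fun j => by
    rw [pointDerivation_apply]
    exact (hcomp' j).fderiv_eq
  have hpi : ∀ x j, fderiv ℂ (fun z => G z j) c₀ x = fderiv ℂ G c₀ x j := fun x j => by
    rw [fderiv_pi hdiffj]
    rfl
  refine span_eq_top_of_injective_pi _ fun x y hxy => ?_
  have hinj := injective_fderiv_written F m₀ hFd hdF
  refine hinj (funext fun j => ?_)
  have := congrFun hxy j
  simp only [hδ, hpi] at this
  exact this

end Immersion

end AffineChart

end Literature.AlgebraicGeometry.Motives.ProjectiveManifold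

end
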